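import Summits.AtomisticToContinuum.Crystallization.Theorems.FrustratedLawDichotomyStrainedPatchHomLeafBridgeW
import Summits.AtomisticToContinuum.Crystallization.Theorems.FrustratedLawDichotomyStrainedPatchHomGramHcp

/-!
# The (P4) hcp GRAM-LEAF BRIDGE (two-sublattice family, 13 extended Gram coordinates): term checks + one integer-data inequality ⟹ leaf floor (def-free)

decomp-a2c hand-2 g21 (crux `AperiodicFrustratedLawGap`, stmt-AtomisticToContinuum-27623).  hcp twin of `…HomLeafBridgeW.boxSum_ge_of_termChecks2` over hand-1's
`…HomGramHcp.boxSumHcp_ge_of_gramLeaf`: coordinates `κ = (Fin 3 × Fin 3) ⊕ (Fin 3 ⊕ Fin 1)` carrying `(⟪U fᵢ, U fⱼ⟫, ⟪U fᵢ, U t⟫, ‖U t‖²)` as scaled integers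
`c0 : κ → ℤ` with half-widths `w : κ → ℤ`; labels `b ∈ box` (UNSHIFTED, functional `bᵢbⱼ` on the Gram block) and `b ∈ box'` (SHIFTED, functional
`(bᵢbⱼ, 2bᵢ, 1)`) — both INTEGER functionals, so the range centre `q0` and radius `r` of every term are exact integers as in the fcc case.  The per-term checks
are the v2 reflected checks `curvOK2 / valLoOK2 / derivOK2` (the record potential is the same W₄₅), the gradient enclosure is SIGNED (interval-sum over both
families before the absolute value).  Conclusion: `μ/SC ≤ Σ_{b∈box} W₄₅‖latPt U f b‖ + Σ_{b∈box'} W₄₅‖latPt U f b + U t‖` for every `U, t` with extended Gram data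
in the box — with `box = [−7,7]³∖0`, `box' = [−7,7]³`, `f = hexFrame`, `t = U⁻¹…` instantiated by the cover theorem's hcp leaf.  Generic in `box, box', f, t`.
0 sorry; no definitions; standard axioms.  `--supports stmt-AtomisticToContinuum-27623`.
-/

noncomputable section

namespace Summit.AtomisticToContinuum.Crystallization.Theorems.FrustratedLawDichotomyStrainedPatchHomLeafBridgeHcp

open scoped BigOperators RealInnerProductSpace
open Set
open Literature.Analysis.ValidatedNumerics.Numerics
open Summit.AtomisticToContinuum.Crystallization.Theorems.ChargedEnergyGapNegative (E3)
open Summit.AtomisticToContinuum.Crystallization.Theorems.FrustratedLawDichotomySchurCut (effPot w₄₅ ω₄)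
open Summit.AtomisticToContinuum.Crystallization.Theorems.FrustratedLawDichotomyStrainedPatchHomSplit (latPt)
open Summit.AtomisticToContinuum.Crystallization.Theorems.FrustratedLawDichotomyStrainedPatchHomTermCalculus (hasDerivAt_phi45)
open Summit.AtomisticToContinuum.Crystallization.Theorems.FrustratedLawDichotomyStrainedPatchHomTermEvalW
  (curvOK2 curvOK2_sound valLoOK2 derivOK2 valLoOK2_sound derivOK2_sound)
open Summit.AtomisticToContinuum.Crystallization.Theorems.FrustratedLawDichotomyStrainedPatchHomLeafBridgeW
  (curvOK2_pos min_mul_le_of_mem mul_le_max_of_mem)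
open Summit.AtomisticToContinuum.Crystallization.Theorems.FrustratedLawDichotomyStrainedPatchHomGramHcp (boxSumHcp_ge_of_gramLeaf)

/-- ★★★ **THE (P4) hcp GRAM-LEAF BRIDGE.**  `Lz v k` below is the INTEGER extended functional (`Sum.elim` over the two families), `q0 v = Σₖ Lz v k · c0ₖ`,
`r v = Σₖ |Lz v k| · wₖ`; hypotheses = the three v2 term checks per label of `box ⊕ box'` and ONE real inequality in the integer data (signed gradient).
[folklore] -/
theorem boxSumHcp_ge_of_termChecks2 (box box' : Finset (Fin 3 → ℤ)) (f : Fin 3 → E3) (c0 w : (Fin 3 × Fin 3) ⊕ (Fin 3 ⊕ Fin 1) → ℤ)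
    (M V Dlo Dhi : (Fin 3 → ℤ) ⊕ (Fin 3 → ℤ) → ℤ) (μ : ℤ) (hw : ∀ k, 0 ≤ w k)
    (Lz : (Fin 3 → ℤ) ⊕ (Fin 3 → ℤ) → (Fin 3 × Fin 3) ⊕ (Fin 3 ⊕ Fin 1) → ℤ)
    (hLz : Lz = Sum.elim (fun b => Sum.elim (fun ij : Fin 3 × Fin 3 => b ij.1 * b ij.2) (fun _ => (0 : ℤ)))
      (fun b => Sum.elim (fun ij : Fin 3 × Fin 3 => b ij.1 * b ij.2) (Sum.elim (fun i : Fin 3 => 2 * b i) (fun _ => (1 : ℤ)))))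
    (hcurv : ∀ v ∈ box.disjSum box', curvOK2 (∑ k, Lz v k * c0 k - ∑ k, |Lz v k| * w k) (∑ k, Lz v k * c0 k + ∑ k, |Lz v k| * w k) (M v) = true)
    (hval : ∀ v ∈ box.disjSum box', valLoOK2 (∑ k, Lz v k * c0 k) (V v) = true)
    (hder : ∀ v ∈ box.disjSum box', derivOK2 (∑ k, Lz v k * c0 k) (Dlo v) (Dhi v) = true)
    (hineq : (μ : ℝ) / SC ≤
      ∑ v ∈ box.disjSum box', (V v : ℝ) / SC -
        ∑ k, max (|∑ v ∈ box.disjSum box', min (((Dlo v : ℝ) / SC) * (Lz v k : ℝ)) (((Dhi v : ℝ) / SC) * (Lz v k : ℝ))|)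
          (|∑ v ∈ box.disjSum box', max (((Dlo v : ℝ) / SC) * (Lz v k : ℝ)) (((Dhi v : ℝ) / SC) * (Lz v k : ℝ))|) * ((w k : ℝ) / SC) -
        1 / 2 * ∑ v ∈ box.disjSum box', ((M v : ℝ) / SC) * (∑ k, |(Lz v k : ℝ)| * ((w k : ℝ) / SC)) ^ 2)
    (U : E3 →L[ℝ] E3) (t : E3)
    (hbox : ∀ k, |(Sum.elim (fun ij : Fin 3 × Fin 3 => ⟪U (f ij.1), U (f ij.2)⟫)
      (Sum.elim (fun i : Fin 3 => ⟪U (f i), U t⟫) (fun _ => ‖U t‖ ^ 2)) k) - (c0 k : ℝ) / SC| ≤ (w k : ℝ) / SC) :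
    (μ : ℝ) / SC ≤ ∑ b ∈ box, effPot w₄₅ ω₄ (3 / 400) ‖latPt U f b‖ + ∑ b ∈ box', effPot w₄₅ ω₄ (3 / 400) ‖latPt U f b + U t‖ := by
  have hS := SC_pos
  -- the real functional of hand-1's lemma is the cast of the integer one
  set L : (Fin 3 → ℤ) ⊕ (Fin 3 → ℤ) → (Fin 3 × Fin 3) ⊕ (Fin 3 ⊕ Fin 1) → ℝ := Sum.elim
      (fun b => Sum.elim (fun ij : Fin 3 × Fin 3 => ((b ij.1 : ℝ) * (b ij.2 : ℝ))) (fun _ => (0 : ℝ)))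
      (fun b => Sum.elim (fun ij : Fin 3 × Fin 3 => ((b ij.1 : ℝ) * (b ij.2 : ℝ)))
        (Sum.elim (fun i : Fin 3 => 2 * (b i : ℝ)) (fun _ => (1 : ℝ)))) with hLdef
  have hLcast : ∀ v k, L v k = ((Lz v k : ℤ) : ℝ) := by
    intro v k; subst hLz
    rcases v with b | b <;> rcases k with ij | i | u <;> simp [L]
  have hq0 : ∀ v, ∑ k, L v k * ((c0 k : ℝ) / SC) = ((∑ k, Lz v k * c0 k : ℤ) : ℝ) / SC := by
    intro v; simp only [hLcast]; push_cast; rw [Finset.sum_div]; exact Finset.sum_congr rfl fun k _ => by ring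
  have hr : ∀ v, ∑ k, |L v k| * ((w k : ℝ) / SC) = ((∑ k, |Lz v k| * w k : ℤ) : ℝ) / SC := by
    intro v; simp only [hLcast]; push_cast; rw [Finset.sum_div]; exact Finset.sum_congr rfl fun k _ => by ring
  refine boxSumHcp_ge_of_gramLeaf (effPot w₄₅ ω₄ (3 / 400)) (fun s => deriv (effPot w₄₅ ω₄ (3 / 400)) (Real.sqrt s) / (2 * Real.sqrt s))
    box box' f (fun v => (M v : ℝ) / SC) (fun k => (c0 k : ℝ) / SC) (fun k => (w k : ℝ) / SC) ((μ : ℝ) / SC)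
    (fun k => div_nonneg (by exact_mod_cast hw k) hS.le) (fun v hv => (curvOK2_sound (hcurv v hv)).1) L hLdef (fun v hv s hs => ?_)
    (fun v hv => ?_) ?_ U t hbox
  · have hpos := curvOK2_pos (hcurv v hv)
    rw [hq0, hr, ← sub_div] at hs
    have : (0:ℝ) < s := by
      have h0 : (0:ℝ) < ((∑ k, Lz v k * c0 k - ∑ k, |Lz v k| * w k : ℤ) : ℝ) / SC := div_pos (by exact_mod_cast hpos) hS
      push_cast at h0 hs
      exact h0.trans_le hs.1
    exact hasDerivAt_phi45 this
  · have h := (curvOK2_sound (hcurv v hv)).2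
    rw [hq0, hr, ← sub_div, ← add_div]
    push_cast at h ⊢
    exact h
  · have hVb : ∀ v ∈ box.disjSum box', (V v : ℝ) / SC ≤ effPot w₄₅ ω₄ (3 / 400) (Real.sqrt (∑ k, L v k * ((c0 k : ℝ) / SC))) := by
      intro v hv; rw [hq0]; exact valLoOK2_sound (hval v hv)
    have hD : ∀ v ∈ box.disjSum box', ∀ k,
        min (((Dlo v : ℝ) / SC) * (Lz v k : ℝ)) (((Dhi v : ℝ) / SC) * (Lz v k : ℝ)) ≤
          deriv (effPot w₄₅ ω₄ (3 / 400)) (Real.sqrt (∑ j, L v j * ((c0 j : ℝ) / SC))) /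
            (2 * Real.sqrt (∑ j, L v j * ((c0 j : ℝ) / SC))) * L v k ∧
        deriv (effPot w₄₅ ω₄ (3 / 400)) (Real.sqrt (∑ j, L v j * ((c0 j : ℝ) / SC))) /
            (2 * Real.sqrt (∑ j, L v j * ((c0 j : ℝ) / SC))) * L v k ≤
          max (((Dlo v : ℝ) / SC) * (Lz v k : ℝ)) (((Dhi v : ℝ) / SC) * (Lz v k : ℝ)) := by
      intro v hv k
      have hm := derivOK2_sound (hder v hv)
      rw [← hq0] at hm
      rw [hLcast]
      exact ⟨min_mul_le_of_mem hm.1 hm.2, mul_le_max_of_mem hm.1 hm.2⟩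
    have h1 := Finset.sum_le_sum hVb
    have h2 : ∀ k, |∑ v ∈ box.disjSum box', deriv (effPot w₄₅ ω₄ (3 / 400)) (Real.sqrt (∑ j, L v j * ((c0 j : ℝ) / SC))) /
            (2 * Real.sqrt (∑ j, L v j * ((c0 j : ℝ) / SC))) * L v k| * ((w k : ℝ) / SC) ≤
        max (|∑ v ∈ box.disjSum box', min (((Dlo v : ℝ) / SC) * (Lz v k : ℝ)) (((Dhi v : ℝ) / SC) * (Lz v k : ℝ))|)
          (|∑ v ∈ box.disjSum box', max (((Dlo v : ℝ) / SC) * (Lz v k : ℝ)) (((Dhi v : ℝ) / SC) * (Lz v k : ℝ))|) * ((w k : ℝ) / SC) := by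
      intro k
      refine mul_le_mul_of_nonneg_right ?_ (div_nonneg (by exact_mod_cast hw k) hS.le)
      exact abs_le_max_abs_abs (Finset.sum_le_sum fun v hv => (hD v hv k).1) (Finset.sum_le_sum fun v hv => (hD v hv k).2)
    have h2' := Finset.sum_le_sum fun k (_ : k ∈ (Finset.univ : Finset ((Fin 3 × Fin 3) ⊕ (Fin 3 ⊕ Fin 1)))) => h2 k
    have h3 : ∀ v, (∑ k, |L v k| * ((w k : ℝ) / SC)) = (∑ k, |(Lz v k : ℝ)| * ((w k : ℝ) / SC)) := fun v => by simp only [hLcast]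
    simp only [h3] at h1 ⊢
    linarith [h1, h2', hineq]

end Summit.AtomisticToContinuum.Crystallization.Theorems.FrustratedLawDichotomyStrainedPatchHomLeafBridgeHcp

end
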